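import Summits.Schanuel.Schanuel.Theses.TateNomes
import Literature.NumberTheory.Transcendental.GammaPointsDense
import Literature.Barriers.Schanuel.LargeTranscendenceDegree
import HarnessLib

/-!
# Route `TateNomes`, crux `NomeTransfer` (item stmt-Schanuel-17405) — stub `stub_spanDescent`

Line `trdeg-bookkeeping`, registered stub 2 of 3 (the load-bearing one): **span descent through
`exp`**.  If every `wⱼ` lies in `span_ℚ (range z ∪ range e)` then
`trdeg_ℚ ℚ(w, e^w) ≤ trdeg_ℚ ℚ(z, e, e^z, e^e)`.

Proof (folklore): for `s ∈ span_ℚ T` one has `s ∈ ℚ(T) ⊆ L := ℚ(T, exp T)`, and writing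
`s = ∑ qᵢ tᵢ` with common denominator `d`, `exp(s)^d` is a Laurent monomial in the `exp tᵢ ∈ L`;
hence `s` and `exp s` lie in the relative algebraic closure `M` of `L` in `ℂ` (induction on the
span: `exp (x + y) = exp x · exp y`, `exp (q • x) ^ den q = exp (x) ^ num q`).  So
`ℚ(S, exp S) ≤ M` for `S ⊆ span_ℚ T`, and `trdeg_ℚ M = trdeg_ℚ L` because `M/L` is algebraic.
The set-level lemmas `mem_and_exp_mem_of_mem_span` / `trdeg_le_of_subset_span` are the ones of the
landed sibling `Theorems/DiophantineDichotomyKhovanskiiApproxTypeEvUnanchoring.lean` (private there;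
reproduced here verbatim), specialised to `S = range w`, `T = range z ∪ range e` with
`exp '' range f = range (exp ∘ f)` and `exp '' (A ∪ B) = exp '' A ∪ exp '' B`.

Tools: `Literature.Barriers.Schanuel.trdeg_mono`,
`Literature.NumberTheory.Transcendental.trdeg_le_of_isAlgebraic`, Mathlib's `algebraicClosure`,
`IsAlgebraic.of_pow`, `Submodule.span_induction`.

Note on the `ℚ`-algebra diamond on subfields of `ℂ` (`DivisionRing.toRatAlgebra`, found here by
instance search, vs the generic `IntermediateField.algebra'` of the imported lemmas): the two are
defeq, so generic lemmas are applied with `exact`/`trans` (unification), never with `rw`.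
-/

-- D-0017: the doubled `Schanuel.Schanuel` path component is the mandated summit/sub-problem namespace
set_option linter.dupNamespace false

namespace Summit.Schanuel.Schanuel.Theorems.TateNomesNomeTransfer

open Complex IntermediateField
open Literature.Barriers.Schanuel (trdeg_mono)
open Literature.NumberTheory.Transcendental (trdeg_le_of_isAlgebraic)

/-- If `s ∈ span_ℚ T` then `s` and `exp s` lie in the relative algebraic closure `M` of
`L = ℚ(T, exp T)` in `ℂ`: `s ∈ ℚ(T) ⊆ L`, and for `s = ∑ qᵢ tᵢ` with common denominator `d`,
`exp(s)^d` is a Laurent monomial in the `exp tᵢ ∈ L`, so `exp s` is algebraic over `L`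
(induction on the span: `exp(x + y) = exp x · exp y`, `exp(q x)^{den q} = exp(x)^{num q}`).
Copied from `Theorems/DiophantineDichotomyKhovanskiiApproxTypeEvUnanchoring.lean` (private there).
[folklore] -/
theorem mem_and_exp_mem_of_mem_span (T : Set ℂ) {s : ℂ} (hs : s ∈ Submodule.span ℚ T) :
    s ∈ (algebraicClosure (adjoin ℚ (T ∪ cexp '' T)) ℂ).restrictScalars ℚ ∧
      cexp s ∈ (algebraicClosure (adjoin ℚ (T ∪ cexp '' T)) ℂ).restrictScalars ℚ := by
  set L := adjoin ℚ (T ∪ cexp '' T)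
  set M := (algebraicClosure L ℂ).restrictScalars ℚ
  have hLM : ∀ x ∈ L, x ∈ M := fun x hx =>
    (mem_restrictScalars ℚ).2 (mem_algebraicClosure_iff.2 (isAlgebraic_algebraMap (⟨x, hx⟩ : L)))
  induction hs using Submodule.span_induction with
  | mem x hx =>
    exact ⟨hLM x (subset_adjoin ℚ _ (Or.inl hx)), hLM _ (subset_adjoin ℚ _ (Or.inr ⟨x, hx, rfl⟩))⟩
  | zero => exact ⟨zero_mem M, by rw [Complex.exp_zero]; exact one_mem M⟩
  | add x y _ _ hx hy =>
    exact ⟨add_mem hx.1 hy.1, by rw [Complex.exp_add]; exact mul_mem hx.2 hy.2⟩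
  | smul q x _ hx =>
    refine ⟨M.smul_mem hx.1, ?_⟩
    have hpow : cexp (q • x) ^ q.den = cexp x ^ q.num := by
      rw [← Complex.exp_nat_mul, ← Complex.exp_int_mul, Rat.smul_def, ← mul_assoc]
      congr 2
      have h := Rat.den_mul_eq_num q
      exact_mod_cast congrArg (Rat.cast : ℚ → ℂ) h
    have halg : IsAlgebraic L (cexp (q • x) ^ q.den) := by
      rw [hpow]
      exact mem_algebraicClosure_iff.1 ((mem_restrictScalars ℚ).1 (zpow_mem hx.2 _))
    exact (mem_restrictScalars ℚ).2 (mem_algebraicClosure_iff.2 (IsAlgebraic.of_pow q.den_pos halg))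

/-- **`t(S) ≤ t(T)` whenever `S ⊆ span_ℚ T`**, where `t(S) = trdeg_ℚ ℚ(S, exp S)`: the field
`ℚ(S, exp S)` lies in the relative algebraic closure of `ℚ(T, exp T)` in `ℂ`
(`mem_and_exp_mem_of_mem_span`), whose transcendence degree is that of `ℚ(T, exp T)`
(`trdeg_le_of_isAlgebraic`).
Copied from `Theorems/DiophantineDichotomyKhovanskiiApproxTypeEvUnanchoring.lean` (private there).
[folklore] -/
theorem trdeg_le_of_subset_span {S T : Set ℂ} (h : S ⊆ Submodule.span ℚ T) :
    Algebra.trdeg ℚ (adjoin ℚ (S ∪ cexp '' S)) ≤ Algebra.trdeg ℚ (adjoin ℚ (T ∪ cexp '' T)) := by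
  set L := adjoin ℚ (T ∪ cexp '' T)
  set M := (algebraicClosure L ℂ).restrictScalars ℚ
  have hLM : L ≤ M := fun x hx =>
    (mem_restrictScalars ℚ).2 (mem_algebraicClosure_iff.2 (isAlgebraic_algebraMap (⟨x, hx⟩ : L)))
  have hSM : adjoin ℚ (S ∪ cexp '' S) ≤ M := by
    rw [adjoin_le_iff]
    rintro x (hx | ⟨s, hs, rfl⟩)
    · exact (mem_and_exp_mem_of_mem_span T (h hx)).1
    · exact (mem_and_exp_mem_of_mem_span T (h hs)).2
  exact (trdeg_mono hSM).trans
    (trdeg_le_of_isAlgebraic hLM fun x hx =>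
      mem_algebraicClosure_iff.1 ((mem_restrictScalars ℚ).1 hx))

/-- Set bookkeeping: `T ∪ exp '' T` for `T = range z ∪ range e` is the four-fold union of ranges
used by the crux. [folklore] -/
theorem union_image_exp_eq {n k : ℕ} (z : Fin n → ℂ) (e : Fin k → ℂ) :
    (Set.range z ∪ Set.range e) ∪ cexp '' (Set.range z ∪ Set.range e) =
      Set.range z ∪ Set.range e ∪ (Set.range (cexp ∘ z) ∪ Set.range (cexp ∘ e)) := by
  rw [Set.image_union, ← Set.range_comp, ← Set.range_comp]

/-- **STUB 2 — span descent through `exp`** (registered on stmt-Schanuel-17405, line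
`trdeg-bookkeeping`). If every `wⱼ` lies in `span_ℚ (range z ∪ range e)` then
`trdeg_ℚ ℚ(w, e^w) ≤ trdeg_ℚ ℚ(z, e, e^z, e^e)`. [folklore] -/
theorem stub_spanDescent :
    ∀ (m n k : ℕ) (w : Fin m → ℂ) (z : Fin n → ℂ) (e : Fin k → ℂ),
      Set.range w ⊆ (Submodule.span ℚ (Set.range z ∪ Set.range e) : Set ℂ) →
      Algebra.trdeg ℚ ↥(IntermediateField.adjoin ℚ (Set.range w ∪ Set.range (Complex.exp ∘ w))) ≤
        Algebra.trdeg ℚ ↥(IntermediateField.adjoin ℚ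
          (Set.range z ∪ Set.range e ∪ (Set.range (Complex.exp ∘ z) ∪ Set.range (Complex.exp ∘ e)))) := by
  intro m n k w z e hw
  have h := trdeg_le_of_subset_span hw
  rw [← Set.range_comp, union_image_exp_eq] at h
  exact h

/-- Curried form of `stub_spanDescent`. [folklore] -/
theorem trdeg_exp_le_of_range_subset_span {m n k : ℕ} {w : Fin m → ℂ} {z : Fin n → ℂ}
    {e : Fin k → ℂ} (hw : Set.range w ⊆ (Submodule.span ℚ (Set.range z ∪ Set.range e) : Set ℂ)) :
    Algebra.trdeg ℚ ↥(IntermediateField.adjoin ℚ (Set.range w ∪ Set.range (Complex.exp ∘ w))) ≤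
      Algebra.trdeg ℚ ↥(IntermediateField.adjoin ℚ
        (Set.range z ∪ Set.range e ∪ (Set.range (Complex.exp ∘ z) ∪ Set.range (Complex.exp ∘ e)))) :=
  stub_spanDescent m n k w z e hw

end Summit.Schanuel.Schanuel.Theorems.TateNomesNomeTransfer
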